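import Literature.MeasureTheory.Group.OrbitalMeasureOfProd     -- ★ `orbitalMeasureOfProd` (`μ₁ ⊠ μ₂`), `integral_descConj_orbitalMeasureOfProd` (exact factorisation for `Φ = ξ ⊗ Θ`)
import Literature.MeasureTheory.Group.InvariantQuotientOrbitalProd     -- ★ `exists_integral_descConj_eq_smul_mul` (ANY invariant `μ` on `G ⧸ C(γ)`: `= c·(∫ξ)(∫Θ)`, Folland Thm. 2.49)
import Mathlib.MeasureTheory.Measure.Dirac
import Mathlib.MeasureTheory.Integral.Bochner.Basic
import HarnessLib

/-!
# Orbital integrals on `G ≅ G₁ × A` with `A` COMMUTATIVE need no factorisation of the test function: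
# `∫_{G/C(γ)} Φ(yγy⁻¹) d(μ₁ ⊠ μ₂) = μ₂(A ∕ C(u)) · ∫_{G₁/C(γ₁)} Φ(e(aγ₁a⁻¹, u)) dμ₁(a)` for `γ = e(γ₁, u)`
(Gelbart, *Automorphic forms on adele groups* (1975), p. 155 (10.19); Rogawski 1990 §14.3 p. 234: `H_∞ = U(Φ₂) × U(Φ₁)` with `U(Φ₁)` abelian)

Topic `MeasureTheory/Group`; namespace `Literature.MeasureTheory.Group`.  THEOREMS ONLY (no definition, no instance, no notation, no named fact, no `sorry`).  Cell `pub/hodgecm-mathlib`,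
ENGINE T1 (crux H413 = `stmt-HodgeConjecture-24833`); floor-1 generic brick for the ROAD-Sd residual R3 «(S-c) central vanishing» (`stub_ScCore` of the line `F0_P3a_SdArch`; census
`CENSUS-R3-ScCentralVanishing.F0P3a-p02g10.md` item (R3-b) «`H_∞ = G₂ × A`, `A` abelian ⇒ orbital integrals on `H_∞` are those of `G₂` on the section `g ↦ f(g, u)`»); author F0P3a-p02 (g10).

WHY.  The endoscopic group at `∞` is `H_∞ = U(Φ₂)(L ⊗ ℝ) × U(Φ₁)(L ⊗ ℝ)` with the SECOND factor abelian (`U(1)` at each place).  Its orbital integrals — the `H`-side of (4.3.1) and the input of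
Harish-Chandra's limit formula at the centre of `H_∞` — are integrals over `H_∞ ∕ C(γ_H) ≅ U(Φ₂)_∞ ∕ C(γ₂) × (pt)`, so they are orbital integrals on the 2-block ALONE of the section `g ↦ aH(g, u)`; no tensor structure
of `aH` is needed (conjugation by the abelian factor is trivial).  ★ `OrbitalMeasureOfProd` proves the exact factorisation for FACTORISABLE `Φ = ξ ⊗ Θ`; this file removes that hypothesis when the second
factor is commutative: on the orbit of `γ = e(γ₁, u)` every `Φ` agrees with the factorisable `y ↦ Φ(e((e⁻¹ y).1, u)) · 1`.

WHAT IS PROVED (generic: `e : G₁ × A ≃* G` bicontinuous, `A` a commutative topological group, `γ = e(γ₁, u)`, measures `μ₁` on `G₁ ∕ C(γ₁)`, `μ₂` on `A ∕ C(u)`):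
* `conj_eq_of_comm` (`k u k⁻¹ = u` in `A`), `descConj_eq_descConj_section` — the orbital integrand of ANY `Φ` at `γ` equals that of the factorisable section function;
* **`integral_descConj_orbitalMeasureOfProd_of_comm`** — `∫_{G/C(γ)} Φ(yγy⁻¹) d(μ₁ ⊠ μ₂) = (∫_{G₁/C(γ₁)} Φ(e(aγ₁a⁻¹, u)) dμ₁(a)) · (μ₂ univ).toReal`;
* `coe_centralizer_singleton_eq_univ_of_comm`, `isClosed_centralizer_singleton_of_comm`, `smul_quotient_centralizer_eq_of_comm`, `smulInvariantMeasure_quotient_centralizer_of_comm`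
  (`C(u) = A`, so `A ⧸ C(u)` is a point on which `A` acts trivially and every measure is invariant);
* **`exists_integral_descConj_eq_smul_of_comm`** — for ANY non-zero invariant measure `μ` on `G ⧸ C(γ)` and `μ₁` on `G₁ ⧸ C(γ₁)` (finite on compact sets, `C(γ₁)` closed) ONE constant
  `c ≠ 0` with `∫_{G/C(γ)} Φ(yγy⁻¹) dμ = c · ∫_{G₁/C(γ₁)} Φ(e(aγ₁a⁻¹, u)) dμ₁(a)` for every `Φ : G → ℂ` (uniqueness of invariant measures, ★ `exists_integral_descConj_eq_smul_mul` with the Dirac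
  mass on the point `A ⧸ C(u)`).
HONEST LABEL: HC_CM is proved only modulo the printed citations until rung 0 closes; this file is generic measure bookkeeping and pays nothing by itself.

## References
* [Gelbart1975] S. Gelbart, *Automorphic Forms on Adele Groups*, Ann. of Math. Stud. 83 (1975), p. 155 (10.19) (orbital integrals over a product factor).
* [Rogawski1990] J. D. Rogawski, *Automorphic Representations of Unitary Groups in Three Variables*, Ann. of Math. Stud. 123 (1990), §14.3 p. 234 (`H_∞`), §4.9 p. 54 (`H = U(2) × U(1)`).
* [Folland1995] G. B. Folland, *A Course in Abstract Harmonic Analysis* (1995), §2.6 Thm. 2.49.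
-/

set_option autoImplicit false

noncomputable section

open MeasureTheory MeasureTheory.Measure Topology Filter
open scoped NNReal ENNReal

namespace Literature.MeasureTheory.Group

section Comm

/-- In a commutative group, conjugation is trivial: `k u k⁻¹ = u` (the abelian factor of (10.19)). [cite: Gelbart1975, p. 155 (10.19)] -/
theorem conj_eq_of_comm {A : Type*} [CommGroup A] (k u : A) : k * u * k⁻¹ = u := by
  rw [mul_comm k u, mul_inv_cancel_right]

end Comm

section CommFactor

variable {G₁ A G : Type*} [Group G₁] [CommGroup A] [Group G]
  [TopologicalSpace G₁] [TopologicalSpace A] [IsTopologicalGroup G₁] [IsTopologicalGroup A] [TopologicalSpace G]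
  (e : G₁ × A ≃* G) {γ : G} {γ₁ : G₁} {u : A} (hγ : e (γ₁, u) = γ) (he : Continuous e) (hes : Continuous e.symm)
  [MeasurableSpace (G ⧸ Subgroup.centralizer ({γ} : Set G))] [BorelSpace (G ⧸ Subgroup.centralizer ({γ} : Set G))]
  [MeasurableSpace (G₁ ⧸ Subgroup.centralizer ({γ₁} : Set G₁))] [BorelSpace (G₁ ⧸ Subgroup.centralizer ({γ₁} : Set G₁))]
  [MeasurableSpace (A ⧸ Subgroup.centralizer ({u} : Set A))] [BorelSpace (A ⧸ Subgroup.centralizer ({u} : Set A))]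
  [SecondCountableTopology (G₁ ⧸ Subgroup.centralizer ({γ₁} : Set G₁))] [SecondCountableTopology (A ⧸ Subgroup.centralizer ({u} : Set A))]
  (μ₁ : Measure (G₁ ⧸ Subgroup.centralizer ({γ₁} : Set G₁))) (μ₂ : Measure (A ⧸ Subgroup.centralizer ({u} : Set A)))

include hγ in
omit [TopologicalSpace G₁] [TopologicalSpace A] [IsTopologicalGroup G₁] [IsTopologicalGroup A] [TopologicalSpace G]
  [MeasurableSpace (G ⧸ Subgroup.centralizer ({γ} : Set G))] [BorelSpace (G ⧸ Subgroup.centralizer ({γ} : Set G))]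
  [MeasurableSpace (G₁ ⧸ Subgroup.centralizer ({γ₁} : Set G₁))] [BorelSpace (G₁ ⧸ Subgroup.centralizer ({γ₁} : Set G₁))]
  [MeasurableSpace (A ⧸ Subgroup.centralizer ({u} : Set A))] [BorelSpace (A ⧸ Subgroup.centralizer ({u} : Set A))]
  [SecondCountableTopology (G₁ ⧸ Subgroup.centralizer ({γ₁} : Set G₁))] [SecondCountableTopology (A ⧸ Subgroup.centralizer ({u} : Set A))] in
/-- **On the orbit of `γ = e(γ₁, u)` every test function agrees with its factorisable SECTION** `y ↦ Φ(e((e⁻¹ y).1, u))`: for `y = e(a, k)`,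
`y γ y⁻¹ = e(a γ₁ a⁻¹, k u k⁻¹) = e(a γ₁ a⁻¹, u)`. [cite: Gelbart1975, p. 155 (10.19)] -/
theorem descConj_eq_descConj_section {E : Type*} (Φ : G → E) :
    descConj γ (Subgroup.centralizer ({γ} : Set G)) (centralizer_comm γ) Φ =
      descConj γ (Subgroup.centralizer ({γ} : Set G)) (centralizer_comm γ) (fun y : G => Φ (e ((e.symm y).1, u))) := by
  funext x
  induction x using QuotientGroup.induction_on with
  | H y =>
    simp only [descConj_mk]
    obtain ⟨p, rfl⟩ : ∃ p : G₁ × A, e p = y := ⟨e.symm y, e.apply_symm_apply y⟩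
    rw [← hγ, ← map_mul, ← map_inv, ← map_mul, e.symm_apply_apply]
    have hp : p * (γ₁, u) * p⁻¹ = ((p * (γ₁, u) * p⁻¹).1, u) :=
      Prod.ext rfl (show p.2 * u * p.2⁻¹ = u from conj_eq_of_comm p.2 u)
    exact congrArg (fun q : G₁ × A => Φ (e q)) hp

include he hes in
omit [SecondCountableTopology (G₁ ⧸ Subgroup.centralizer ({γ₁} : Set G₁))] in
/-- **ORBITAL INTEGRALS ON `G ≅ G₁ × A`, `A` COMMUTATIVE**: for EVERY `Φ : G → ℂ`,
`∫_{G/C(γ)} Φ(yγy⁻¹) d(μ₁ ⊠ μ₂)(y) = (∫_{G₁/C(γ₁)} Φ(e(aγ₁a⁻¹, u)) dμ₁(a)) · (μ₂ univ).toReal` — the orbital integral on the product is the orbital integral on the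
non-abelian factor of the section at `u`, times the mass of the (one-point) orbit space of the abelian factor (★ `integral_descConj_orbitalMeasureOfProd` for the section with
`Θ ≡ 1`). [cite: Gelbart1975, p. 155 (10.19)] [cite: Rogawski1990, §14.3 p. 234] -/
theorem integral_descConj_orbitalMeasureOfProd_of_comm [SFinite μ₁] [SFinite μ₂] (Φ : G → ℂ) :
    ∫ y, descConj γ (Subgroup.centralizer ({γ} : Set G)) (centralizer_comm γ) Φ y ∂orbitalMeasureOfProd e hγ μ₁ μ₂ =
      (∫ x, descConj γ₁ (Subgroup.centralizer ({γ₁} : Set G₁)) (centralizer_comm γ₁) (fun g : G₁ => Φ (e (g, u))) x ∂μ₁) * (μ₂ Set.univ).toReal := by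
  rw [descConj_eq_descConj_section e hγ Φ,
    integral_descConj_orbitalMeasureOfProd e hγ μ₁ μ₂ he hes (fun y : G => Φ (e ((e.symm y).1, u))) (fun g : G₁ => Φ (e (g, u))) (fun _ : A => (1 : ℂ))
      (fun a k => by simp only [MulEquiv.symm_apply_apply, mul_one])]
  congr 1
  have h1 : descConj u (Subgroup.centralizer ({u} : Set A)) (centralizer_comm u) (fun _ : A => (1 : ℂ)) = fun _ => (1 : ℂ) := by
    funext x
    induction x using QuotientGroup.induction_on with
    | H k => rfl
  rw [h1, integral_const, Complex.real_smul, mul_one]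
  rfl

end CommFactor

/-! ### Arbitrary invariant measures on `G ⧸ C(γ)`: the constant `c` (uniqueness of invariant measures) -/

section CommQuotient

variable {A : Type*} [CommGroup A] (u : A)

/-- In a commutative group the centraliser of any element is everything (the abelian factor of (10.19)). [cite: Gelbart1975, p. 155 (10.19)] -/
theorem coe_centralizer_singleton_eq_univ_of_comm : ((Subgroup.centralizer ({u} : Set A) : Subgroup A) : Set A) = Set.univ :=
  Set.eq_univ_iff_forall.2 fun k => Subgroup.mem_centralizer_iff.2 fun v hv => by
    rw [Set.mem_singleton_iff.1 hv, mul_comm]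

/-- … hence closed, in any topology (the closedness input of ★ `exists_integral_descConj_eq_smul_mul` at an abelian factor). [cite: Gelbart1975, p. 155 (10.19)] -/
theorem isClosed_centralizer_singleton_of_comm [TopologicalSpace A] : IsClosed ((Subgroup.centralizer ({u} : Set A) : Subgroup A) : Set A) := by
  rw [coe_centralizer_singleton_eq_univ_of_comm]
  exact isClosed_univ

/-- `A` acts trivially on the point `A ⧸ C(u)` (abelian factor of (10.19)). [cite: Gelbart1975, p. 155 (10.19)] -/
theorem smul_quotient_centralizer_eq_of_comm (k : A) (x : A ⧸ Subgroup.centralizer ({u} : Set A)) : k • x = x := by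
  induction x using QuotientGroup.induction_on with
  | H a =>
    rw [MulAction.Quotient.smul_coe, QuotientGroup.eq]
    exact (Set.eq_univ_iff_forall.1 (coe_centralizer_singleton_eq_univ_of_comm u)) _

/-- Every measure on the point `A ⧸ C(u)` is `A`-invariant (abelian factor of (10.19); the degenerate case of Folland Thm. 2.49). [cite: Gelbart1975, p. 155 (10.19)] [cite: Folland1995, Thm. 2.49] -/
theorem smulInvariantMeasure_quotient_centralizer_of_comm [MeasurableSpace (A ⧸ Subgroup.centralizer ({u} : Set A))]
    (μ₂ : Measure (A ⧸ Subgroup.centralizer ({u} : Set A))) : SMulInvariantMeasure A (A ⧸ Subgroup.centralizer ({u} : Set A)) μ₂ := by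
  refine ⟨fun k s _ => ?_⟩
  have h : (fun x : A ⧸ Subgroup.centralizer ({u} : Set A) => k • x) ⁻¹' s = s := by
    ext x
    simp only [Set.mem_preimage, smul_quotient_centralizer_eq_of_comm]
  rw [h]

end CommQuotient

section CommFactorInvariant

variable {G₁ A G : Type*} [Group G₁] [CommGroup A] [Group G]
  [TopologicalSpace G₁] [TopologicalSpace A] [TopologicalSpace G]
  [IsTopologicalGroup G₁] [IsTopologicalGroup A]
  [LocallyCompactSpace G₁] [LocallyCompactSpace A]
  [SecondCountableTopology G₁] [SecondCountableTopology A] [T2Space G₁] [T2Space A]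
  (e : G₁ × A ≃* G) (he : Continuous e) (hes : Continuous e.symm) {γ : G} {γ₁ : G₁} {u : A}
  (hγ : e (γ₁, u) = γ)
  (hC₁ : IsClosed ((Subgroup.centralizer ({γ₁} : Set G₁) : Subgroup G₁) : Set G₁))
  [MeasurableSpace (G ⧸ Subgroup.centralizer ({γ} : Set G))] [BorelSpace (G ⧸ Subgroup.centralizer ({γ} : Set G))]
  [MeasurableSpace (G₁ ⧸ Subgroup.centralizer ({γ₁} : Set G₁))] [BorelSpace (G₁ ⧸ Subgroup.centralizer ({γ₁} : Set G₁))]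
  (μ : Measure (G ⧸ Subgroup.centralizer ({γ} : Set G)))
  [SMulInvariantMeasure G (G ⧸ Subgroup.centralizer ({γ} : Set G)) μ] [IsFiniteMeasureOnCompacts μ]
  (μ₁ : Measure (G₁ ⧸ Subgroup.centralizer ({γ₁} : Set G₁)))
  [SMulInvariantMeasure G₁ (G₁ ⧸ Subgroup.centralizer ({γ₁} : Set G₁)) μ₁] [IsFiniteMeasureOnCompacts μ₁] [SFinite μ₁]

include he hes hγ hC₁ in
/-- **ORBITAL INTEGRALS ON `G ≅ G₁ × A` (`A` COMMUTATIVE) FOR ANY INVARIANT MEASURE**: for non-zero invariant measures `μ` on `G ⧸ C(γ)`, `μ₁` on `G₁ ⧸ C(γ₁)` finite on compact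
sets (`C(γ₁)` closed, `γ = e(γ₁, u)`) there is ONE constant `c ≠ 0` with, for EVERY `Φ : G → ℂ`,
`∫_{G/C(γ)} Φ(yγy⁻¹) dμ(y) = c · ∫_{G₁/C(γ₁)} Φ(e(aγ₁a⁻¹, u)) dμ₁(a)`
(★ `exists_integral_descConj_eq_smul_mul` for the factorisable section `Φ(e((e⁻¹y).1, u)) · 1` and the Dirac mass on the point `A ⧸ C(u)`; no integrability hypotheses — both sides use the
same convention for divergent integrals).  This is the shape in which the endoscopic orbital integrals on `H_∞ = U(Φ₂)_∞ × U(Φ₁)_∞` enter (4.3.1) and Harish-Chandra's limit formula on the 2-block.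
[cite: Gelbart1975, p. 155 (10.19)] [cite: Folland1995, Thm. 2.49] [cite: Rogawski1990, §14.3 p. 234] -/
theorem exists_integral_descConj_eq_smul_of_comm (hμ : μ ≠ 0) (h₁ : μ₁ ≠ 0) :
    ∃ c : ℝ≥0, c ≠ 0 ∧ ∀ Φ : G → ℂ,
      ∫ y, descConj γ (Subgroup.centralizer ({γ} : Set G)) (centralizer_comm γ) Φ y ∂μ =
        c • ∫ x, descConj γ₁ (Subgroup.centralizer ({γ₁} : Set G₁)) (centralizer_comm γ₁) (fun g : G₁ => Φ (e (g, u))) x ∂μ₁ := by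
  letI : MeasurableSpace (A ⧸ Subgroup.centralizer ({u} : Set A)) := borel _
  haveI : BorelSpace (A ⧸ Subgroup.centralizer ({u} : Set A)) := ⟨rfl⟩
  set μ₂ : Measure (A ⧸ Subgroup.centralizer ({u} : Set A)) := Measure.dirac ((1 : A) : A ⧸ Subgroup.centralizer ({u} : Set A)) with hμ₂
  haveI : SMulInvariantMeasure A (A ⧸ Subgroup.centralizer ({u} : Set A)) μ₂ := smulInvariantMeasure_quotient_centralizer_of_comm u μ₂
  obtain ⟨c, hc0, hc⟩ := exists_integral_descConj_eq_smul_mul e he hes hγ hC₁ (isClosed_centralizer_singleton_of_comm u) μ μ₁ μ₂ hμ h₁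
    (IsProbabilityMeasure.ne_zero μ₂)
  refine ⟨c, hc0, fun Φ => ?_⟩
  rw [descConj_eq_descConj_section e hγ Φ,
    hc (fun y : G => Φ (e ((e.symm y).1, u))) (fun g : G₁ => Φ (e (g, u))) (fun _ : A => (1 : ℂ))
      (fun a k => by simp only [MulEquiv.symm_apply_apply, mul_one])]
  have h1 : descConj u (Subgroup.centralizer ({u} : Set A)) (centralizer_comm u) (fun _ : A => (1 : ℂ)) = fun _ => (1 : ℂ) := by
    funext x
    induction x using QuotientGroup.induction_on with
    | H k => rfl
  rw [h1, integral_const, probReal_univ, one_smul, mul_one]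

end CommFactorInvariant

end Literature.MeasureTheory.Group

end
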